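import Summits.FinalStateConjecture.FinalStateConjecture.Theorems.SwallowTheDatumUniversalWitnessFamilyRegionOneAssembly

/-!
# Crux `StarvedNecks.HonestFixedRadiusSettling` (stmt-FinalStateConjecture-13550), line `far-field-surgery`
# (reshape v6, sheet burial), stub `stub_regionOneHoleClauses`

Two honest clauses for the `t*`-bent hole chart `Ψ y = holeMap M T₀ y` of region I of Schwarzschild
(`Kerr.region 0 (2M)` in ingoing Kerr–Schild coordinates, hole background `B = boostedKerrBackground 1 0 M 0`
with time `y⁰` and radius `‖ỹ‖`), `T₀` a late time (`|∂_t bend| ≤ 1/2` after `T₀`):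

* (Hc.2, ANCHORING) a hole-late image point `Ψ x` with `T₀ + 1 < x⁰ < τ₂`, `‖x̃‖ < ϱ` lies in the causal past
  of the image of the truncated slab `{y⁰ = τ₂, ‖ỹ‖ ≤ ϱ}`: the point `Ψ (τ₂, x̃)` has the same spatial part and
  a later Kerr–Schild time (`t ↦ t + bend M t r` is strictly increasing on `[T₀, ∞)`,
  `strictMonoOn_add_bend`), so it is a future vertical translate `vert (Ψ x) s`, `s ≥ 0`, of `Ψ x` along the
  static Killing field (`mem_causalPast_vert`);
* (Hc.3, CLOSEDNESS) for `τ' > T₀ + 1` and continuous `ϱ` the image of `{τ' ≤ y⁰, ‖ỹ‖ ≤ ϱ(y⁰)}` is closed in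
  region I: along a sequence of image points converging in the region the chart times are `≥ τ'` and bounded
  above by the convergent Kerr–Schild times (`bend ≥ 0`), a subsequence of them converges, the preimages then
  converge in `E4` to a point of the (closed) coordinate set off the horizon, and continuity of `holeMap` there
  identifies the limit as an image point.

References: O'Neill 1983, Ch. 14 (causality relations); Misner–Thorne–Wheeler 1973, §31.4; folklore topology.
-/

set_option linter.dupNamespace false

noncomputable section

open scoped Manifold ContDiff Topology
open Set Filter Function Literature.Geometry.Lorentzian
open Summit.FinalStateConjecture.FinalStateConjecture.Theorems.SwallowTheDatum.UniversalWitnessFamily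
  (torH staticTime excision exactRadius bend holeMap outMap vert ksTime)

namespace Summit.FinalStateConjecture.FinalStateConjecture.Theorems.StarvedNecks.SheetBurial

section Proofs

open Summit.FinalStateConjecture.FinalStateConjecture.Theorems.SwallowTheDatum.UniversalWitnessFamily

variable {M T₀ : ℝ}
  (Ψ : (boostedKerrBackground 1 0 M 0).domain → Kerr.region 0 (Kerr.rPlus M 0))
  (hΨ : ∀ y, (Ψ y : E4) = holeMap M T₀ y)

include hΨ in
/-- **(Hc.2) Anchoring of the hole chart by the static Killing flow.** A hole-late image point `Ψ x` with
`T₀ + 1 < x⁰ < τ₂` and `‖x̃‖ < ϱ` lies in the causal past of the image of the truncated slab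
`{y⁰ = τ₂, ‖ỹ‖ ≤ ϱ}`: the image of `(τ₂, x̃)` is the vertical translate `vert (Ψ x) s` with
`s = (τ₂ + bend M τ₂ r) − (x⁰ + bend M x⁰ r) ≥ 0`, `r = ‖x̃‖`. -/
private theorem image_holeChart_subset_causalPast_truncTimeSlab [Kerr.Facts] (hM : 0 < M)
    (hmono : ∀ t r : ℝ, T₀ ≤ t → 2 * M < r → |deriv (fun t ↦ bend M t r) t| ≤ 1 / 2)
    (ϱ τ₂ : ℝ) (hτ₂ : T₀ + 1 < τ₂) :
    Ψ '' {x | T₀ + 1 < (boostedKerrBackground 1 0 M 0).time x.1 ∧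
        (boostedKerrBackground 1 0 M 0).time x.1 < τ₂ ∧ (boostedKerrBackground 1 0 M 0).radius x.1 < ϱ} ⊆
      (Kerr.smoothMetric M 0 (Kerr.rPlus M 0)).causalPast (ksTime hM.le)
        (Ψ '' (boostedKerrBackground 1 0 M 0).truncTimeSlab ϱ τ₂) := by
  rintro _ ⟨x, hx, rfl⟩
  simp only [mem_setOf_eq, holeBackground_time, holeBackground_radius] at hx
  obtain ⟨hx1, hx2, hx3⟩ := hx
  have hxr : 2 * M < E4.spatialNorm x.1 := (mem_holeDomain hM.le).1 x.2
  -- the fibre map `t ↦ t + bend M t r` is strictly increasing on `[T₀, ∞)`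
  have hlt : x.1 0 + bend M (x.1 0) (E4.spatialNorm x.1) < τ₂ + bend M τ₂ (E4.spatialNorm x.1) :=
    strictMonoOn_add_bend hM hmono hxr (show T₀ ≤ x.1 0 by linarith) (show T₀ ≤ τ₂ by linarith) hx2
  set s : ℝ := (τ₂ + bend M τ₂ (E4.spatialNorm x.1)) - (x.1 0 + bend M (x.1 0) (E4.spatialNorm x.1)) with hs
  have hs0 : 0 ≤ s := by rw [hs]; linarith
  have hΨx0 : (Ψ x).1 0 = x.1 0 + bend M (x.1 0) (E4.spatialNorm x.1) := by
    rw [hΨ, holeMap_of_le M hx1.le, bentMap_apply_zero]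
  have hΨxr : E4.spatialNorm (Ψ x).1 = E4.spatialNorm x.1 := by rw [hΨ, spatialNorm_holeMap]
  -- the vertical translate `vert (Ψ x) s` is the image of the slab point `(τ₂, x̃)`
  have hq : vert (Ψ x) s ∈ Ψ '' (boostedKerrBackground 1 0 M 0).truncTimeSlab ϱ τ₂ := by
    refine mem_image_holeChart Ψ hΨ hM (vert (Ψ x) s) (t := τ₂) hτ₂.le ?_ fun y hy ↦ ?_
    · rw [vert_apply_zero, spatialNorm_vert, hΨx0, hΨxr, hs]; ring
    · rw [ModelBackground.mem_truncTimeSlab, holeBackground_time, holeBackground_radius, hy,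
        spatialNorm_add_smul_basisVector, spatialNorm_vert, hΨxr]
      exact ⟨by simp, hx3.le⟩
  exact LorentzianMetric.causalFuture_mono (singleton_subset_iff.2 hq) (mem_causalPast_vert hM (Ψ x) hs0)

include hΨ in
/-- **(Hc.3) Late tube portions of the hole chart are closed in region I.** For `τ' > T₀ + 1` and continuous
`ϱ`, the image under `Ψ` of the coordinate set `{τ' ≤ y⁰, ‖ỹ‖ ≤ ϱ(y⁰)}` is closed in `Kerr.region 0 (2M)`:
sequential closure in `E4`, boundedness of the chart times (`τ' ≤ yₙ⁰ ≤ yₙ⁰ + bend = (Ψ yₙ)⁰`, convergent), a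
convergent subsequence of them, and continuity of `holeMap` off the horizon. -/
private theorem closure_image_holeChart_tube_subset (hM : 0 < M) (τ' : ℝ) (ϱ : ℝ → ℝ) (hϱ : Continuous ϱ)
    (hτ' : T₀ + 1 < τ') :
    closure (Ψ '' {x | τ' ≤ (boostedKerrBackground 1 0 M 0).time x.1 ∧
        (boostedKerrBackground 1 0 M 0).radius x.1 ≤ ϱ ((boostedKerrBackground 1 0 M 0).time x.1)}) ⊆
      Ψ '' {x | τ' ≤ (boostedKerrBackground 1 0 M 0).time x.1 ∧
        (boostedKerrBackground 1 0 M 0).radius x.1 ≤ ϱ ((boostedKerrBackground 1 0 M 0).time x.1)} := by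
  intro a ha
  set A : Set (boostedKerrBackground 1 0 M 0).domain := {x | τ' ≤ (boostedKerrBackground 1 0 M 0).time x.1 ∧
    (boostedKerrBackground 1 0 M 0).radius x.1 ≤ ϱ ((boostedKerrBackground 1 0 M 0).time x.1)} with hA
  -- pass to the coordinate space `E4` (sequential there)
  have ha' : (a : E4) ∈ closure ((fun x : (boostedKerrBackground 1 0 M 0).domain ↦ holeMap M T₀ x.1) '' A) := by
    refine map_mem_closure continuous_subtype_val ha ?_
    rintro _ ⟨x, hx, rfl⟩
    exact ⟨x, hx, (hΨ x).symm⟩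
  obtain ⟨u, huA, hu⟩ := mem_closure_iff_seq_limit.1 ha'
  choose y hyA hyu using huA
  have hyu' : ∀ n, holeMap M T₀ (y n).1 = u n := fun n ↦ hyu n
  have hmemA : ∀ n, τ' ≤ (y n).1 0 ∧ E4.spatialNorm (y n).1 ≤ ϱ ((y n).1 0) := fun n ↦ by
    have h := hyA n
    simp only [hA, mem_setOf_eq, holeBackground_time, holeBackground_radius] at h
    exact h
  -- the chart images in coordinates: `u n = y n + bend • e₀`
  have hu0 : ∀ n, u n 0 = (y n).1 0 + bend M ((y n).1 0) (E4.spatialNorm (y n).1) := fun n ↦ by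
    rw [← hyu' n, holeMap_of_le M (by linarith [(hmemA n).1]), bentMap_apply_zero]
  have huy : ∀ n, ((y n).1 : E4) = u n + ((y n).1 0 - u n 0) • E4.basisVector 0 := fun n ↦ by
    have h1 : u n = (y n).1 + bend M ((y n).1 0) (E4.spatialNorm (y n).1) • E4.basisVector 0 := by
      rw [← hyu' n, holeMap_of_le M (by linarith [(hmemA n).1]), bentMap_eq]
    rw [hu0 n, h1, add_assoc, ← add_smul]
    have h2 : bend M ((y n).1 0) (E4.spatialNorm (y n).1) +
        ((y n).1 0 - ((y n).1 0 + bend M ((y n).1 0) (E4.spatialNorm (y n).1))) = 0 := by ring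
    rw [h2, zero_smul, add_zero]
  -- the chart times are bounded: `τ' ≤ (y n)⁰ ≤ (u n)⁰ → a⁰`
  have hc0 : Continuous fun p : E4 ↦ p 0 := PiLp.continuous_apply 2 _ 0
  have hu0t : Tendsto (fun n ↦ u n 0) atTop (𝓝 (a.1 0)) := (hc0.tendsto _).comp hu
  obtain ⟨T, hT⟩ := hu0t.bddAbove_range
  have htI : ∀ n, (y n).1 0 ∈ Icc τ' T := fun n ↦ by
    refine ⟨(hmemA n).1, ?_⟩
    have h1 : u n 0 ≤ T := hT (Set.mem_range_self n)
    have h2 := bend_nonneg ((y n).1 0) (E4.spatialNorm (y n).1) hM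
    linarith [hu0 n]
  obtain ⟨tstar, htstar, φ, hφ, hφt⟩ := IsCompact.tendsto_subseq (x := fun n ↦ (y n).1 0) isCompact_Icc htI
  -- the limit of the preimages along the subsequence
  set z : E4 := a.1 + (tstar - a.1 0) • E4.basisVector 0 with hz
  have hzr : E4.spatialNorm z = E4.spatialNorm a.1 := spatialNorm_add_smul_basisVector _ _
  have hz0 : z 0 = tstar := by rw [hz]; simp
  have hz2 : 2 * M < E4.spatialNorm z := by rw [hzr]; exact two_mul_lt_spatialNorm hM.le a
  have hzd : z ∈ (boostedKerrBackground 1 0 M 0).domain := (mem_holeDomain hM.le).2 hz2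
  have hyz : Tendsto (fun n ↦ ((y (φ n)).1 : E4)) atTop (𝓝 z) := by
    have h1 : Tendsto (fun n ↦ u (φ n)) atTop (𝓝 a.1) := hu.comp hφ.tendsto_atTop
    have h2 : Tendsto (fun n ↦ u (φ n) 0) atTop (𝓝 (a.1 0)) := hu0t.comp hφ.tendsto_atTop
    have h3 : Tendsto (fun n ↦ (y (φ n)).1 0) atTop (𝓝 tstar) := hφt
    have h4 : Tendsto (fun n ↦ u (φ n) + ((y (φ n)).1 0 - u (φ n) 0) • E4.basisVector 0) atTop (𝓝 z) := by
      rw [hz]; exact h1.add ((h3.sub h2).smul_const _)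
    exact h4.congr fun n ↦ (huy (φ n)).symm
  -- continuity of `holeMap` at `z` identifies `holeMap z = a`
  have hcont : ContinuousAt (holeMap M T₀) z := (contDiffAt_holeMap hM T₀ hz2 (n := 0)).continuousAt
  have hlim1 : Tendsto (fun n ↦ holeMap M T₀ (y (φ n)).1) atTop (𝓝 (holeMap M T₀ z)) := hcont.tendsto.comp hyz
  have hlim2 : Tendsto (fun n ↦ holeMap M T₀ (y (φ n)).1) atTop (𝓝 a.1) := by
    have h : (fun n ↦ holeMap M T₀ (y (φ n)).1) = fun n ↦ u (φ n) := funext fun n ↦ hyu' (φ n)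
    rw [h]; exact hu.comp hφ.tendsto_atTop
  have heq : holeMap M T₀ z = a.1 := tendsto_nhds_unique hlim1 hlim2
  -- `z` lies in the coordinate set
  have hzA : (⟨z, hzd⟩ : (boostedKerrBackground 1 0 M 0).domain) ∈ A := by
    simp only [hA, mem_setOf_eq, holeBackground_time, holeBackground_radius]
    refine ⟨by rw [hz0]; exact htstar.1, ?_⟩
    rw [hz0]
    have hl : Tendsto (fun n ↦ E4.spatialNorm (y (φ n)).1) atTop (𝓝 (E4.spatialNorm z)) :=
      ((continuous_norm.comp E4.spatial.continuous).tendsto z).comp hyz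
    have hr : Tendsto (fun n ↦ ϱ ((y (φ n)).1 0)) atTop (𝓝 (ϱ tstar)) := (hϱ.tendsto tstar).comp hφt
    exact le_of_tendsto_of_tendsto' hl hr fun n ↦ (hmemA (φ n)).2
  exact ⟨⟨z, hzd⟩, hzA, Subtype.ext (by rw [hΨ]; exact heq)⟩

end Proofs

/-- **Stub `stub_regionOneHoleClauses` of line `far-field-surgery` (Hc.2 ANCHORING and Hc.3 CLOSED LATE TUBE
PORTIONS for the `t*`-bent hole chart `holeMap M T₀` of region I).**  With `B = boostedKerrBackground 1 0 M 0`
(time `y⁰`, radius `‖ỹ‖`, domain `{‖ỹ‖ > 2M}`) and the hole chart `Ψ y = holeMap M T₀ y = (y⁰ + bend M y⁰ ‖ỹ‖, ỹ)`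
on `{y⁰ ≥ T₀ + 1}`: (Hc.2) a hole-late image point with `T₀ + 1 < y⁰ < τ₂`, `‖ỹ‖ < ϱ` lies in the causal past of
the image of the truncated slab `{y⁰ = τ₂, ‖ỹ‖ ≤ ϱ}` — same spatial point, later Kerr–Schild time since
`t ↦ t + bend M t r` is strictly increasing on `[T₀, ∞)`, joined by the vertical static orbit; (Hc.3) for
`τ' > T₀ + 1` and continuous `ϱ` the image of `{τ' ≤ y⁰, ‖ỹ‖ ≤ ϱ(y⁰)}` is closed in region I. [folklore] -/
theorem stub_regionOneHoleClauses :
    ∀ [Kerr.Facts] (M : ℝ) (hM : 0 < M) (T₀ : ℝ),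
      (∀ t r : ℝ, T₀ ≤ t → 2 * M < r → |deriv (fun t ↦ bend M t r) t| ≤ 1 / 2) →
      ∀ (Ψ : (boostedKerrBackground 1 0 M 0).domain → Kerr.region 0 (Kerr.rPlus M 0)),
      (∀ y, (Ψ y : E4) = holeMap M T₀ y) →
      (∀ (ϱ τ₂ : ℝ), T₀ + 1 < τ₂ →
        Ψ '' {x | T₀ + 1 < (boostedKerrBackground 1 0 M 0).time x.1 ∧
            (boostedKerrBackground 1 0 M 0).time x.1 < τ₂ ∧ (boostedKerrBackground 1 0 M 0).radius x.1 < ϱ} ⊆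
          (Kerr.smoothMetric M 0 (Kerr.rPlus M 0)).causalPast (ksTime hM.le)
            (Ψ '' (boostedKerrBackground 1 0 M 0).truncTimeSlab ϱ τ₂)) ∧
      (∀ (τ' : ℝ) (ϱ : ℝ → ℝ), Continuous ϱ → T₀ + 1 < τ' →
        closure (Ψ '' {x | τ' ≤ (boostedKerrBackground 1 0 M 0).time x.1 ∧
            (boostedKerrBackground 1 0 M 0).radius x.1 ≤ ϱ ((boostedKerrBackground 1 0 M 0).time x.1)}) ⊆
          Ψ '' {x | τ' ≤ (boostedKerrBackground 1 0 M 0).time x.1 ∧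
            (boostedKerrBackground 1 0 M 0).radius x.1 ≤ ϱ ((boostedKerrBackground 1 0 M 0).time x.1)}) := by
  intro _ M hM T₀ hmono Ψ hΨ
  exact ⟨fun ϱ τ₂ hτ₂ ↦ image_holeChart_subset_causalPast_truncTimeSlab Ψ hΨ hM hmono ϱ τ₂ hτ₂,
    fun τ' ϱ hϱ hτ' ↦ closure_image_holeChart_tube_subset Ψ hΨ hM τ' ϱ hϱ hτ'⟩

end Summit.FinalStateConjecture.FinalStateConjecture.Theorems.StarvedNecks.SheetBurial

end
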